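import Literature.MathematicalPhysics.QuantumLattice.InfVolFermionStateTorusLimitTwoSectorEnergyEntropyBalance
import Literature.MathematicalPhysics.QuantumLattice.TorusLimitOfMixturesCompactness
import HarnessLib

/-!
# Companion limits exist: for every thermal torus limit of the `t–t'` Hubbard model there are, along a
# subsequence, a torus limit of the IMAGE-sector canonical states and a limit of the partition-function
# ratio — the joint data of the two-sector energy–entropy balance rows

Topic `Literature/MathematicalPhysics/QuantumLattice`; complement of
`InfVolFermionStateTorusLimitTwoSectorEnergyEntropyBalance.lean`, whose theorem
`IsTorusLimitOfMixture.re_expect_twoSector_eeb_nonneg_of_sectorGibbs` proves the charged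
energy–entropy balance rows of the thermal object of record `ω` (a torus limit of the canonical Gibbs
states on the sectors `(rectN n L, S^z = 0)` along `Ls → ∞`) in TWO-STATE form — GIVEN a companion torus
limit `ω'` of the canonical states of the image spin sector `(a'_L, b'_L)` along the same `Ls` and the
limit `r` of the ratio of canonical partition functions. A reader who wants to conclude something about
EVERY `ω` from a certificate valid for all admissible `(ω', r)` needs the companion data to EXIST; this
file packages the compactness argument:

* `IsTorusLimitOfMixture.exists_twoSector_companion_of_sectorGibbs` — if the image sectors are
  eventually nonempty (`a'_L, b'_L ≤ L²` along `Ls`) and the ratio is eventually in a bracket `[c₁, c₂]`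
  (hypothesis by name: at finite volume it is supplied by the two-sector brackets
  `log_div_sub_div_le_log_partitionFn_ratio_torus` / `log_partitionFn_ratio_le_log_div_add_div_torus`
  with one generator, e.g. a single annihilator whose `x`, `y'` moments are exact densities), then there
  are a strictly increasing `φ`, a state `ω'` and `r ∈ [c₁, c₂]` such that `ω` is (still) the torus limit
  of the object of record along `Ls ∘ φ`, `ω'` is the torus limit of the image-sector canonical mixtures
  along `Ls ∘ φ`, and the ratio converges to `r` along `Ls ∘ φ` — exactly the hypotheses of the rows
  theorem (weak-⋆ compactness `InfVolFermionState.exists_isTorusLimitOfMixture_subseq`, stability under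
  subsequences `IsTorusLimitOfMixture.comp_tendsto`, Bolzano–Weierstrass on `[c₁, c₂]`);
* `exists_spinConfig_of_le` — the spin sector `(a, b)` of the `L × L` torus is nonempty when
  `a, b ≤ L²`.

HONEST SCOPE: existence along a subsequence, nothing about uniqueness (of `ω'` or `r`) — the consumer
quantifies over all admissible companions; the bracket is an input. Everything is PROVED; no definition,
no named fact.

## Mathlib / tree search

REUSED: `InfVolFermionState.exists_isTorusLimitOfMixture_subseq`, `IsTorusLimitOfMixture.comp_tendsto`
(`TorusLimitOfMixturesCompactness`); `canonicalWeight_nonneg`, `sum_canonicalWeight`,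
`star_sectorEigenvector_dotProduct_self` (`TorusSectorGibbsMixture`); `pairSet`, `upPart_pairSet`,
`downPart_pairSet` (`HubbardLiebConfig`); Mathlib `tendsto_subseq_of_bounded`, `Metric.isBounded_Icc`,
`isClosed_Icc`, `StrictMono.tendsto_atTop`, `Filter.tendsto_add_atTop_nat`, `Finset.exists_subset_card_eq`.
`lean search 'companion|exists.*twoSector'`: nothing (2026-08-27).

## References

* O. Bratteli, D. W. Robinson, *Operator Algebras and Quantum Statistical Mechanics 1* (1987),
  Thm. 2.3.15 (weak-⋆ compactness of the state space), §4.3.1.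
  [cite: BratteliRobinsonI1987, Thm. 2.3.15 (weak-⋆ compactness of the state space) and §4.3.1]
* O. Bratteli, D. W. Robinson, *Operator Algebras and Quantum Statistical Mechanics 2* (1997), §5.4.2
  (the chemical potential as the free-energy cost of a charge). [cite: BratteliRobinsonII1997, §5.4.2]
-/

noncomputable section

namespace Literature.MathematicalPhysics.QuantumLattice

open Matrix Finset HubbardWave0 Literature.Probability.LatticeModels ThermodynamicLimit
open _root_.Filter
open scoped _root_.Topology ComplexOrder BigOperators

/-- **The spin sector `(a, b)` of the `L × L` torus is nonempty when `a, b ≤ L²`** (take `a` up-orbitals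
and `b` down-orbitals). [cite: LiebPRL1989, proof of Theorem 1] -/
theorem exists_spinConfig_of_le (L : ℕ) {a b : ℕ} (ha : a ≤ L * L) (hb : b ≤ L * L) :
    ∃ s : Finset (Orb (FermionTorus 2 L)), spinConfig a b s := by
  classical
  have hcard : Fintype.card (FermionTorus 2 L) = L * L := by simp [FermionTorus, sq]
  obtain ⟨α, -, hα⟩ : ∃ α : Finset (FermionTorus 2 L), α ⊆ univ ∧ α.card = a :=
    Finset.exists_subset_card_eq (by rw [Finset.card_univ, hcard]; exact ha)
  obtain ⟨γ, -, hγ⟩ : ∃ γ : Finset (FermionTorus 2 L), γ ⊆ univ ∧ γ.card = b :=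
    Finset.exists_subset_card_eq (by rw [Finset.card_univ, hcard]; exact hb)
  refine ⟨pairSet α γ, ?_, ?_⟩
  · rw [upPart_pairSet, hα]
  · rw [downPart_pairSet, hγ]

namespace InfVolFermionState

/-- **Companion limits of the thermal object of record exist along a subsequence.** Let `ω` be a torus
limit of the canonical Gibbs states of `hubbardTorusTT' (Ls j) t t' U` at inverse temperature `β` on the
sectors `(rectN n (Ls j), S^z = 0)` along `Ls → ∞`; let `(a'_L, b'_L)` be image spin sectors with
`a'_{Ls j}, b'_{Ls j} ≤ (Ls j)²` eventually, and suppose the ratio of canonical partition functions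
`Z_{(a',b')}(Ls j)/Z_{(k,k)}(Ls j)` lies eventually in `[c₁, c₂]`. Then there are a strictly increasing
`φ`, a state `ω'` and `r ∈ [c₁, c₂]` with: `ω` is the torus limit of the object of record along `Ls ∘ φ`,
`ω'` is the torus limit of the image-sector canonical eigen-mixtures along `Ls ∘ φ`, and the ratio tends
to `r` along `Ls ∘ φ` — the joint data consumed by
`IsTorusLimitOfMixture.re_expect_twoSector_eeb_nonneg_of_sectorGibbs`.
[cite: BratteliRobinsonI1987, Thm. 2.3.15 (weak-⋆ compactness of the state space) and §4.3.1]
[cite: BratteliRobinsonII1997, §5.4.2] -/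
theorem IsTorusLimitOfMixture.exists_twoSector_companion_of_sectorGibbs (t t' U β : ℝ) {n : ℝ}
    {Ls : ℕ → ℕ} (hLs : Tendsto Ls atTop atTop) {ω : InfVolFermionState 2}
    (hω : ω.IsTorusLimitOfMixture (sectorGibbsCount n) (fun L => sectorGibbsWeightTT' β t t' U n L)
      (fun L => sectorGibbsVectorTT' t t' U n L) Ls)
    (a' b' : ℕ → ℕ) (hab : ∀ᶠ j in atTop, a' (Ls j) ≤ Ls j * Ls j ∧ b' (Ls j) ≤ Ls j * Ls j)
    {c₁ c₂ : ℝ} (hρ : ∀ᶠ j in atTop,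
      (∑ d, Real.exp (-(β * sectorEigenvalue (spinConfig (a' (Ls j)) (b' (Ls j)))
          (hubbardTorusTT' (Ls j) t t' U) (hubbardTorusTT'_isHermitian (Ls j) t t' U) d))) /
        (∑ c, Real.exp (-(β * sectorEigenvalue (szConfig n (Ls j)) (hubbardTorusTT' (Ls j) t t' U)
          (hubbardTorusTT'_isHermitian (Ls j) t t' U) c))) ∈ Set.Icc c₁ c₂) :
    ∃ φ : ℕ → ℕ, StrictMono φ ∧ ∃ ω' : InfVolFermionState 2, ∃ r ∈ Set.Icc c₁ c₂,
      ω.IsTorusLimitOfMixture (sectorGibbsCount n) (fun L => sectorGibbsWeightTT' β t t' U n L)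
        (fun L => sectorGibbsVectorTT' t t' U n L) (Ls ∘ φ) ∧
      ω'.IsTorusLimitOfMixture
        (fun L => Fintype.card (Subtype (spinConfig (Λ := FermionTorus 2 L) (a' L) (b' L))))
        (fun L i => canonicalWeight β (sectorEigenvalue (spinConfig (a' L) (b' L)) (hubbardTorusTT' L t t' U)
          (hubbardTorusTT'_isHermitian L t t' U)) ((Fintype.equivFin _).symm i))
        (fun L i => sectorEigenvector (spinConfig (a' L) (b' L)) (hubbardTorusTT' L t t' U)
          (hubbardTorusTT'_isHermitian L t t' U) ((Fintype.equivFin _).symm i)) (Ls ∘ φ) ∧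
      Tendsto (fun j =>
        (∑ d, Real.exp (-(β * sectorEigenvalue (spinConfig (a' (Ls (φ j))) (b' (Ls (φ j))))
            (hubbardTorusTT' (Ls (φ j)) t t' U) (hubbardTorusTT'_isHermitian (Ls (φ j)) t t' U) d))) /
          (∑ c, Real.exp (-(β * sectorEigenvalue (szConfig n (Ls (φ j))) (hubbardTorusTT' (Ls (φ j)) t t' U)
            (hubbardTorusTT'_isHermitian (Ls (φ j)) t t' U) c)))) atTop (𝓝 r) := by
  -- a tail on which the image sector is nonempty and the ratio is bracketed
  obtain ⟨j₀, hj₀⟩ := eventually_atTop.1 (hab.and hρ)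
  set Ls₁ : ℕ → ℕ := fun j => Ls (j + j₀) with hLs₁
  have hLs₁' : Tendsto Ls₁ atTop atTop := hLs.comp (tendsto_add_atTop_nat j₀)
  -- the image-sector data are honest mixtures on the tail
  have hne : ∀ j, Nonempty (Subtype (spinConfig (Λ := FermionTorus 2 (Ls₁ j)) (a' (Ls₁ j)) (b' (Ls₁ j)))) := by
    intro j
    obtain ⟨s, hs⟩ := exists_spinConfig_of_le (Ls₁ j) (hj₀ (j + j₀) (Nat.le_add_left _ _)).1.1
      (hj₀ (j + j₀) (Nat.le_add_left _ _)).1.2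
    exact ⟨⟨s, hs⟩⟩
  have hp0 : ∀ j (i : Fin (Fintype.card (Subtype (spinConfig (Λ := FermionTorus 2 (Ls₁ j)) (a' (Ls₁ j)) (b' (Ls₁ j)))))),
      0 ≤ canonicalWeight β (sectorEigenvalue (spinConfig (a' (Ls₁ j)) (b' (Ls₁ j))) (hubbardTorusTT' (Ls₁ j) t t' U)
        (hubbardTorusTT'_isHermitian (Ls₁ j) t t' U)) ((Fintype.equivFin _).symm i) :=
    fun j i => canonicalWeight_nonneg β _ _
  have hp1 : ∀ j, ∑ i : Fin (Fintype.card (Subtype (spinConfig (Λ := FermionTorus 2 (Ls₁ j)) (a' (Ls₁ j)) (b' (Ls₁ j))))),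
      canonicalWeight β (sectorEigenvalue (spinConfig (a' (Ls₁ j)) (b' (Ls₁ j))) (hubbardTorusTT' (Ls₁ j) t t' U)
        (hubbardTorusTT'_isHermitian (Ls₁ j) t t' U)) ((Fintype.equivFin _).symm i) = 1 := by
    intro j
    haveI := hne j
    rw [Equiv.sum_comp (Fintype.equivFin _).symm (fun c => canonicalWeight β
      (sectorEigenvalue (spinConfig (a' (Ls₁ j)) (b' (Ls₁ j))) (hubbardTorusTT' (Ls₁ j) t t' U)
        (hubbardTorusTT'_isHermitian (Ls₁ j) t t' U)) c)]
    exact sum_canonicalWeight β _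
  have hψ1 : ∀ j (i : Fin (Fintype.card (Subtype (spinConfig (Λ := FermionTorus 2 (Ls₁ j)) (a' (Ls₁ j)) (b' (Ls₁ j)))))),
      star (sectorEigenvector (spinConfig (a' (Ls₁ j)) (b' (Ls₁ j))) (hubbardTorusTT' (Ls₁ j) t t' U)
          (hubbardTorusTT'_isHermitian (Ls₁ j) t t' U) ((Fintype.equivFin _).symm i)) ⬝ᵥ
        sectorEigenvector (spinConfig (a' (Ls₁ j)) (b' (Ls₁ j))) (hubbardTorusTT' (Ls₁ j) t t' U)
          (hubbardTorusTT'_isHermitian (Ls₁ j) t t' U) ((Fintype.equivFin _).symm i) = 1 :=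
    fun j i => star_sectorEigenvector_dotProduct_self _ _ _ _
  -- weak-⋆ compactness for the image mixtures along the tail
  obtain ⟨φ₁, hφ₁, ω', hω'⟩ := InfVolFermionState.exists_isTorusLimitOfMixture_subseq
    (m := fun L => Fintype.card (Subtype (spinConfig (Λ := FermionTorus 2 L) (a' L) (b' L))))
    (fun L i => canonicalWeight β (sectorEigenvalue (spinConfig (a' L) (b' L)) (hubbardTorusTT' L t t' U)
      (hubbardTorusTT'_isHermitian L t t' U)) ((Fintype.equivFin _).symm i))
    (fun L i => sectorEigenvector (spinConfig (a' L) (b' L)) (hubbardTorusTT' L t t' U)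
      (hubbardTorusTT'_isHermitian L t t' U) ((Fintype.equivFin _).symm i)) hLs₁' hp0 hp1 hψ1
  -- Bolzano–Weierstrass for the bracketed ratio along the sub-tail
  set x : ℕ → ℝ := fun j =>
    (∑ d, Real.exp (-(β * sectorEigenvalue (spinConfig (a' (Ls₁ (φ₁ j))) (b' (Ls₁ (φ₁ j))))
        (hubbardTorusTT' (Ls₁ (φ₁ j)) t t' U) (hubbardTorusTT'_isHermitian (Ls₁ (φ₁ j)) t t' U) d))) /
      (∑ c, Real.exp (-(β * sectorEigenvalue (szConfig n (Ls₁ (φ₁ j))) (hubbardTorusTT' (Ls₁ (φ₁ j)) t t' U)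
        (hubbardTorusTT'_isHermitian (Ls₁ (φ₁ j)) t t' U) c))) with hx
  have hxmem : ∀ j, x j ∈ Set.Icc c₁ c₂ := fun j =>
    (hj₀ (φ₁ j + j₀) (Nat.le_add_left _ _)).2
  obtain ⟨r, hr, φ₂, hφ₂, hlim⟩ := tendsto_subseq_of_bounded (Metric.isBounded_Icc c₁ c₂) hxmem
  rw [isClosed_Icc.closure_eq] at hr
  -- assemble
  refine ⟨fun j => φ₁ (φ₂ j) + j₀, fun i j hij => Nat.add_lt_add_right (hφ₁ (hφ₂ hij)) j₀, ω', r, hr,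
    ?_, ?_, ?_⟩
  · exact hω.comp_tendsto (StrictMono.tendsto_atTop fun i j hij => Nat.add_lt_add_right (hφ₁ (hφ₂ hij)) j₀)
  · exact hω'.comp_tendsto hφ₂.tendsto_atTop
  · exact hlim

end InfVolFermionState

end Literature.MathematicalPhysics.QuantumLattice

end
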